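import Summits.HodgeConjecture.HodgeConjecture.Theorems.H413SpectrumJunction
import Literature.NumberTheory.Automorphic.UnitaryGroupCotangentHodgeSplit
import HarnessLib

/-!
# Crux `H413`, floor 0 — THE HODGE SPLITTING INSIDE A DISCRETE AUTOMORPHIC REPRESENTATION, PROVED
# (junction letter J0 = (A′) `CotangentForms.cohFormsContainsFormSplit`, discharged outright)

Cell hodgecm-mathlib (D-0151), crux item `stmt-HodgeConjecture-24833` (`HCCMUnconditional.H413`), programmes P2 ∕ P3 junction
(F0P2-plan PLAN-P2 §5 «J0»; F0P3 ENGINE-INTERFACES «S5 ⇐ E2′ + J1 + J3», J1 shared with (A′)); prover A-p18 (g16).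
PROOF FILE: theorems only — no definition, no instance, no notation, no named fact, no `sorry`; imports = ★ tree + Mathlib.
HONEST LABEL: HC_CM is proved only modulo the printed citations until rung 0 closes; this file consumes no printed citation.

THE LETTER (★ `Literature/NumberTheory/Automorphic/UnitaryGroupCotangentHodgeSplit.lean`, statement-only, F0-typ1 (g0)): for the
unitary group `U(J)` of `(F, E, c)`, an archimedean section `ιinf : U(2,1) →* U(J)(𝔸_F)`, a subgroup `Kc`, an automorphic measure
`μ` and a discrete automorphic `P ⊂ L²(U(J)(F)\U(J)(𝔸_F), μ)`, every cohomological cotangent form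
`Φ ∈ cohForms ιinf Kc = holCotForms ⊔ conj holCotForms` with `P.ContainsForm Φ` splits as `Φ = Φ₁ + Φ₂`, `Φ₁` holomorphic,
`Φ₂` antiholomorphic, BOTH contained in `P`.

THE PROOF (elementary; it is the remark of the letter's own docstring «the central circle `diag(ζ, ζ, 1)` of `U(2)` acts on
`T_{x₀}𝔹² ≅ ℂ²` by the scalar `ζ` resp. `ζ̄`» turned into an argument that needs NO Haar integral, NO isotypic projector and NO
archimedean classification):
* §1 the CENTRAL TORUS ELEMENT `k = diag(i,i,1) ∈ Stab_{U(2,1)}(x₀)` (built here from ★ `BallModel.mkU21`; its Jacobian at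
  `x₀` is the scalar `i`, computed from ★ `BallModel.Jac` as in ★ `UnitBallIsotropy.Jac_kU`) acts through the weight condition of
  ★ `weightForms` on a holomorphic cotangent form by the SCALAR `i` — `Φ(x·ιinf k) = (Jac k x₀)ᵀ Φ(x)` — and on an antiholomorphic
  one (`conjFun` of a holomorphic one) by `ī = −i` ([Borel1997, §5.14]; [BorelWallach2000, VII 2.10]; [Rogawski1990, §12.3 p. 174]);
* §2 `P.ContainsForm` is stable under sums, scalars and RIGHT TRANSLATION BY ANY `h ∈ U(J)(𝔸_F)`: the class of `x ↦ Φ(x h)` is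
  `R(h)` of the class of `Φ` (★ `SpectrumJunction.toLp_toQuotFun_mul_right`, the tree's regular representation
  `(R h f)(y) = f(h⁻¹ • y)`), `P` is an invariant subspace of `R` (`ClosedSubrep`), and `MemLp` is preserved by the measure-preserving
  translation ([BorelJacquet1979, §4.6]; [DeitmarEchterhoff2014, Thm. 7.3.2 (a)]);
* §3 `R_{ιinf k} Φ = i Φ₁ − i Φ₂` and `Φ = Φ₁ + Φ₂` give `Φ₁ = (2i)⁻¹ (R_{ιinf k} Φ + i Φ)`, `Φ₂ = (−2i)⁻¹ (R_{ιinf k} Φ − i Φ)`,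
  linear combinations of forms contained in `P`.
Everything is GENERIC in `(F, E, c, N, J, ιinf, Kc, μ, P)` exactly as the letter quantifies.

## References
* [Borel1997] A. Borel, *Automorphic forms on SL₂(ℝ)*, Cambridge Tracts 130 (1997), §5.14 (weights at the base point).
* [BorelWallach2000] A. Borel, N. Wallach, 2nd ed. (2000), VII 2.10 (Hodge types of harmonic forms).
* [BorelJacquet1979] A. Borel, H. Jacquet, Corvallis PSPM 33.1 (1979), §4.2 (right translation), §4.6 (`L²_d`).
* [DeitmarEchterhoff2014] A. Deitmar, S. Echterhoff, *Principles of Harmonic Analysis*, 2nd ed. (2014), Thm. 7.3.2 (a) (invariant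
  closed subspaces of the regular representation).
* [Rogawski1990] J. Rogawski, Ann. of Math. Stud. 123 (1990), §12.3 p. 174 (`J^±`), Prop. 15.2.1 (b).
* Tree: ★ `Theorems/H413SpectrumJunction` (F0P3-p04 (g0): `toQuotFun` calculus, transport identity, left-invariance of `cohForms`),
  ★ `Literature/…/UnitaryGroupCohomologicalForms` ((A): carriers), ★ `Literature/Geometry/ComplexHyperbolic/UnitBallU21` ∕ `UnitBallJacobian`
  (`mkU21`, `W3_apply`, `smul_val`, `Jac`), ★ `Literature/…/WeightForms` (`WeightForms.right_equiv`), ★ `AutomorphyFactorForms`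
  (`IsPullbackCocycle.weightOf_inv_apply`).
-/

set_option autoImplicit false

-- the mandated namespace has the single-problem summit's repeated segment (`HodgeConjecture.HodgeConjecture`)
set_option linter.dupNamespace false

noncomputable section

namespace Summit.HodgeConjecture.HodgeConjecture.Cruxes.H413.CotangentHodgeSplit

open MeasureTheory
open scoped ENNReal Matrix
open Literature.NumberTheory.Automorphic Literature.NumberTheory.Automorphic.UnitaryGroup
open Literature.NumberTheory.Automorphic.UnitaryGroup.CotangentForms
open Literature.NumberTheory.Automorphic.AutomorphyFactor
open Literature.AlgebraicGeometry.ShimuraVarieties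
open Literature.Geometry.ComplexHyperbolic.BallModel (U21 x₀ Jac mkU21 mat_mkU21 W3 W3_apply smul_val)
open Summit.HodgeConjecture.HodgeConjecture.Cruxes.H413.SpectrumJunction
  (toQuotFun_mul_right_apply toLp_toQuotFun_mul_right leftInvariant_of_mem_cohForms)

/-! ## §1 The central torus element `diag(i,i,1)` of `Stab(x₀)` acts by a scalar on (anti)holomorphic cotangent forms -/

section KType

/-- **The central torus element of the isotropy group and its cotangent action.**  There is `k ∈ Stab_{U(2,1)}(x₀)` — namely
`k = diag(i, i, 1)`, which preserves `J = diag(1,1,−1)` and fixes the origin of the ball — whose Jacobian at `x₀` is the scalar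
`i`: `(Jac k x₀)ᵀ v = i • v` for all `v ∈ ℂ²` (the centre of `U(2) ⊂ U(2) × U(1)` acts on `T_{x₀}𝔹² ≅ ℂ²` by scalars).
[cite: Borel1997, §5.14] [cite: Rogawski1990, §12.3 p. 174] -/
theorem exists_stabilizer_transpose_Jac_eq_I_smul :
    ∃ k : MulAction.stabilizer U21 x₀, ∀ v : Fin 2 → ℂ, (Jac (k : U21) x₀).transpose.mulVec v = Complex.I • v := by
  have hmem : (Matrix.diagonal ![Complex.I, Complex.I, 1])ᴴ * Literature.Geometry.ComplexHyperbolic.BallModel.J *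
      Matrix.diagonal ![Complex.I, Complex.I, 1] = Literature.Geometry.ComplexHyperbolic.BallModel.J := by
    ext i j
    fin_cases i <;> fin_cases j <;>
      simp [Literature.Geometry.ComplexHyperbolic.BallModel.J, Matrix.mul_apply, Matrix.conjTranspose_apply,
        Matrix.diagonal]
  have hW2 : W3 (mkU21 _ hmem) x₀ 2 = 1 := by rw [W3_apply]; simp [Matrix.diagonal]
  have hW0 : W3 (mkU21 _ hmem) x₀ 0 = 0 := by rw [W3_apply]; simp [Matrix.diagonal]
  have hW1 : W3 (mkU21 _ hmem) x₀ 1 = 0 := by rw [W3_apply]; simp [Matrix.diagonal]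
  have hfix : mkU21 _ hmem • x₀ = x₀ := by
    apply Literature.Geometry.ComplexHyperbolic.BallModel.Ball.ext
    intro i
    rw [smul_val]
    fin_cases i <;> simp [hW0, hW1]
  refine ⟨⟨mkU21 _ hmem, MulAction.mem_stabilizer_iff.mpr hfix⟩, fun v => ?_⟩
  have hJac : Jac (mkU21 _ hmem) x₀ = Matrix.diagonal ![Complex.I, Complex.I] := by
    ext i j
    fin_cases i <;> fin_cases j <;> simp [Jac, hW2, hW0, hW1]
  rw [Subgroup.coe_mk, hJac, Matrix.diagonal_transpose]
  funext i
  rw [Matrix.mulVec_diagonal, Pi.smul_apply, smul_eq_mul]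
  fin_cases i <;> simp

variable {F E : Type} [Field F] [NumberField F] [Field E] [NumberField E] [Algebra F E]
  {c : E ≃ₐ[F] E} {N : ℕ} {J : Matrix (Fin N) (Fin N) E}
  {ιinf : U21 →* (adelicGroupData F E c N J).Adelic} {Kc : Subgroup (adelicGroupData F E c N J).Adelic}

/-- **The weight condition of a holomorphic cotangent form, unfolded**: `Φ(x · ιinf k) = (Jac k x₀)ᵀ Φ(x)` for `k ∈ Stab(x₀)`
(★ `weightForms` with the cotangent isotropy representation `weightOf x₀` of ★ `BallForms.cotangentCocycle`).
[cite: Borel1997, §5.14] -/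
theorem apply_mul_stabilizer_of_mem_holCotForms {Φ : (adelicGroupData F E c N J).Adelic → (Fin 2 → ℂ)}
    (hΦ : Φ ∈ holCotForms F E c N J ιinf Kc) (k : MulAction.stabilizer U21 x₀) (x : (adelicGroupData F E c N J).Adelic) :
    Φ (x * ιinf k) = (Jac (k : U21) x₀).transpose.mulVec (Φ x) := by
  have h : Φ (x * ιinf k) = (BallForms.isPullbackCocycle_cotangentCocycle.weightOf x₀) k⁻¹ (Φ x) :=
    WeightForms.right_equiv (mem_holCotForms_iff.mp hΦ).1 k x
  rw [h, IsPullbackCocycle.weightOf_inv_apply, BallForms.cotangentCocycle_apply]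

/-- **A holomorphic cotangent form is an eigenfunction of right translation by the central torus element** `ιinf k`,
`k = diag(i,i,1)`, eigenvalue `i`. [cite: Borel1997, §5.14] [cite: Rogawski1990, §12.3 p. 174] -/
theorem apply_mul_center_of_mem_holCotForms {Φ : (adelicGroupData F E c N J).Adelic → (Fin 2 → ℂ)}
    (hΦ : Φ ∈ holCotForms F E c N J ιinf Kc) {k : MulAction.stabilizer U21 x₀}
    (hk : ∀ v : Fin 2 → ℂ, (Jac (k : U21) x₀).transpose.mulVec v = Complex.I • v)
    (x : (adelicGroupData F E c N J).Adelic) :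
    Φ (x * ιinf k) = Complex.I • Φ x := by
  rw [apply_mul_stabilizer_of_mem_holCotForms hΦ k x, hk]

/-- **An antiholomorphic cotangent form (`conjFun` of a holomorphic one) is an eigenfunction of right translation by
`ιinf k`, `k = diag(i,i,1)`, eigenvalue `ī = −i`.** [cite: BorelWallach2000, VII 2.10] [cite: Rogawski1990, §12.3 p. 174] -/
theorem apply_mul_center_of_mem_map_conjFun {Ψ : (adelicGroupData F E c N J).Adelic → (Fin 2 → ℂ)}
    (hΨ : Ψ ∈ (holCotForms F E c N J ιinf Kc).map (conjFun F E c N J)) {k : MulAction.stabilizer U21 x₀}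
    (hk : ∀ v : Fin 2 → ℂ, (Jac (k : U21) x₀).transpose.mulVec v = Complex.I • v)
    (x : (adelicGroupData F E c N J).Adelic) :
    Ψ (x * ιinf k) = (-Complex.I) • Ψ x := by
  obtain ⟨Φ, hΦ, rfl⟩ := Submodule.mem_map.mp hΨ
  rw [conjFun_apply, conjFun_apply, apply_mul_center_of_mem_holCotForms hΦ hk x, star_smul, Complex.star_def,
    Complex.conj_I]

end KType

/-! ## §2 `ContainsForm` is stable under sums, scalars, differences and right translation (any adelic group datum) -/

section Contains

variable {K : Type} [Field K] [NumberField K] {𝒢 : AdelicGroupData.{0} K}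
  {μ : Measure 𝒢.automorphicQuotient} [SMulInvariantMeasure 𝒢.Adelic 𝒢.automorphicQuotient μ]
  (P : DiscreteAutomorphicRep 𝒢 μ)

/-- `ContainsForm` is additive: the classes of the coordinates of `Φ + Ψ` are the sums of those of `Φ` and `Ψ`
(`MemLp.toLp_add`), and `P` is a subspace. [cite: BorelJacquet1979, §4.6] -/
theorem containsForm_add {Φ Ψ : 𝒢.Adelic → (Fin 2 → ℂ)} (hΦ : P.ContainsForm Φ) (hΨ : P.ContainsForm Ψ) :
    P.ContainsForm (Φ + Ψ) := by
  intro j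
  obtain ⟨h1, m1⟩ := hΦ j
  obtain ⟨h2, m2⟩ := hΨ j
  exact ⟨h1.add h2, P.space.toSubmodule.add_mem m1 m2⟩

/-- `ContainsForm` is stable under differences (`MemLp.toLp_sub`). [cite: BorelJacquet1979, §4.6] -/
theorem containsForm_sub {Φ Ψ : 𝒢.Adelic → (Fin 2 → ℂ)} (hΦ : P.ContainsForm Φ) (hΨ : P.ContainsForm Ψ) :
    P.ContainsForm (Φ - Ψ) := by
  intro j
  obtain ⟨h1, m1⟩ := hΦ j
  obtain ⟨h2, m2⟩ := hΨ j
  exact ⟨h1.sub h2, P.space.toSubmodule.sub_mem m1 m2⟩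

/-- `ContainsForm` is stable under scalars (`MemLp.toLp_const_smul`). [cite: BorelJacquet1979, §4.6] -/
theorem containsForm_smul (a : ℂ) {Φ : 𝒢.Adelic → (Fin 2 → ℂ)} (hΦ : P.ContainsForm Φ) :
    P.ContainsForm (a • Φ) := by
  intro j
  obtain ⟨h1, m1⟩ := hΦ j
  exact ⟨h1.const_smul a, P.space.toSubmodule.smul_mem a m1⟩

/-- **`ContainsForm` is stable under RIGHT TRANSLATION by any `h ∈ G(𝔸_K)`** for a left-`A_G · G(K)`-invariant `Φ`: the class
of `x ↦ Φ(x h)` is `R(h)` of the class of `Φ` (★ `SpectrumJunction.toLp_toQuotFun_mul_right`), `P` is `R`-invariant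
(`ClosedSubrep`), and square-integrability is preserved since `y ↦ h⁻¹ • y` preserves `μ`.
[cite: BorelJacquet1979, §4.6] [cite: DeitmarEchterhoff2014, Thm. 7.3.2 (a)] -/
theorem containsForm_mul_right {Φ : 𝒢.Adelic → (Fin 2 → ℂ)}
    (hleft : ∀ γ ∈ 𝒢.quotientSubgroup, ∀ g, Φ (γ * g) = Φ g) (hP : P.ContainsForm Φ) (h : 𝒢.Adelic) :
    P.ContainsForm (fun x => Φ (x * h)) := by
  intro j
  obtain ⟨hmem, hin⟩ := hP j
  have hleftj : ∀ γ ∈ 𝒢.quotientSubgroup, ∀ g, (fun y => Φ y j) (γ * g) = (fun y => Φ y j) g :=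
    fun γ hγ g => by simp only [hleft γ hγ g]
  have hfun : (toQuotFun 𝒢 fun x => Φ (x * h) j) = fun y => toQuotFun 𝒢 (fun y => Φ y j) (h⁻¹ • y) :=
    funext fun y => toQuotFun_mul_right_apply (Φ := fun y => Φ y j) hleftj h y
  have hmemh : MemLp (toQuotFun 𝒢 fun x => Φ (x * h) j) 2 μ := by
    rw [hfun]
    exact hmem.comp_measurePreserving (measurePreserving_smul h⁻¹ μ)
  refine ⟨hmemh, ?_⟩
  have key : hmemh.toLp (toQuotFun 𝒢 fun x => Φ (x * h) j) =
      𝒢.rightRegular μ h (hmem.toLp (toQuotFun 𝒢 fun y => Φ y j)) :=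
    toLp_toQuotFun_mul_right hleftj h hmem hmemh
  show hmemh.toLp (toQuotFun 𝒢 fun x => Φ (x * h) j) ∈ P.space.toSubmodule
  rw [key]
  exact P.space.apply_mem_toSubmodule h hin

end Contains

/-! ## §3 The letter J0, proved -/

/-- **J0 — the Hodge splitting inside a discrete automorphic representation, PROVED** (discharges the named fact ★
`CotangentForms.cohFormsContainsFormSplit`, F0-typ1 (g0) p791776, BY NAME).  For `Φ = Φ₁ + Φ₂ ∈ holCotForms ⊔ conj holCotForms`
with `P.ContainsForm Φ`: the central torus element `k = diag(i,i,1) ∈ Stab(x₀)` gives `R_{ιinf k} Φ = i Φ₁ − i Φ₂` (§1), so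
`Φ₁ = (2i)⁻¹ (R_{ιinf k} Φ + i Φ)` and `Φ₂ = (−2i)⁻¹ (R_{ιinf k} Φ − i Φ)` are linear combinations of right translates of `Φ`, all
contained in `P` (§2). [cite: DeitmarEchterhoff2014, Thm. 7.3.2 (a)] [cite: BorelJacquet1979, §4.2 and §4.6]
[cite: Rogawski1990, §12.3 p. 174; Prop. 15.2.1 (b)] [cite: BorelWallach2000, VII 2.10] -/
theorem cohFormsContainsFormSplit_holds : CotangentForms.cohFormsContainsFormSplit := by
  intro F E _ _ _ _ _ c N J ιinf Kc μ _ P Φ hΦ hP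
  have hleft : ∀ γ ∈ (adelicGroupData F E c N J).quotientSubgroup, ∀ g, Φ (γ * g) = Φ g :=
    leftInvariant_of_mem_cohForms hΦ
  obtain ⟨Φ₁, h₁, Φ₂, h₂, h12⟩ := Submodule.mem_sup.mp hΦ
  refine ⟨Φ₁, h₁, Φ₂, h₂, h12.symm, ?_⟩
  -- the central torus element `k = diag(i,i,1)` of `Stab(x₀)`, acting on `T_{x₀}𝔹²` by `i`
  obtain ⟨k, hk⟩ := exists_stabilizer_transpose_Jac_eq_I_smul
  have hne : (Complex.I - -Complex.I) ≠ 0 := by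
    rw [sub_neg_eq_add, ← two_mul]
    exact mul_ne_zero two_ne_zero Complex.I_ne_zero
  have hne' : (-Complex.I - Complex.I) ≠ 0 := fun h => hne (by rw [← neg_sub, h, neg_zero])
  -- the right translate of `Φ` by the central torus element and its eigen-decomposition
  have hR : P.ContainsForm (fun x => Φ (x * ιinf k)) := containsForm_mul_right P hleft hP _
  have hRpt : (fun x => Φ (x * ιinf k)) = Complex.I • Φ₁ + (-Complex.I) • Φ₂ := by
    funext x
    rw [← h12, Pi.add_apply, apply_mul_center_of_mem_holCotForms h₁ hk x, apply_mul_center_of_mem_map_conjFun h₂ hk x]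
    rfl
  have hΦ₁ : Φ₁ = (Complex.I - -Complex.I)⁻¹ • ((fun x => Φ (x * ιinf k)) - (-Complex.I) • Φ) := by
    rw [eq_inv_smul_iff₀ hne, hRpt, ← h12]
    funext x
    funext j
    simp only [Pi.smul_apply, Pi.add_apply, Pi.sub_apply, smul_eq_mul]
    ring
  have hΦ₂ : Φ₂ = (-Complex.I - Complex.I)⁻¹ • ((fun x => Φ (x * ιinf k)) - Complex.I • Φ) := by
    rw [eq_inv_smul_iff₀ hne', hRpt, ← h12]
    funext x
    funext j
    simp only [Pi.smul_apply, Pi.add_apply, Pi.sub_apply, smul_eq_mul]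
    ring
  constructor
  · rw [hΦ₁]
    exact containsForm_smul P _ (containsForm_sub P hR (containsForm_smul P _ hP))
  · rw [hΦ₂]
    exact containsForm_smul P _ (containsForm_sub P hR (containsForm_smul P _ hP))

/-- **J0 in detection form — «`cotPart ≠ ⊥ ⇒ Hodge type `(1,0)` or `(0,1)`»** (F0P2-plan PLAN-P2 §5): a NON-ZERO cohomological
cotangent form `Φ ∈ cohForms ιinf Kc` contained in the discrete automorphic `P` exhibits `P` as H¹-cohomological of Hodge type
`(1,0)` or `(0,1)` at the place of `ιinf` (`P.IsHolCotangentAt ιinf Kc ∨ P.IsAntiholCotangentAt ιinf Kc`): one of the two parts of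
the splitting `cohFormsContainsFormSplit_holds` is non-zero. [cite: Rogawski1990, Prop. 15.2.1 (b)] [cite: BorelWallach2000, VII 2.10 and 3.2] -/
theorem isHolCotangentAt_or_isAntiholCotangentAt_of_containsForm
    {F E : Type} [Field F] [NumberField F] [Field E] [NumberField E] [Algebra F E] {c : E ≃ₐ[F] E} {N : ℕ}
    {J : Matrix (Fin N) (Fin N) E} {ιinf : U21 →* (adelicGroupData F E c N J).Adelic}
    {Kc : Subgroup (adelicGroupData F E c N J).Adelic} {μ : Measure (adelicGroupData F E c N J).automorphicQuotient}
    [(adelicGroupData F E c N J).IsAutomorphicMeasure μ] (P : DiscreteAutomorphicRep (adelicGroupData F E c N J) μ)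
    {Φ : (adelicGroupData F E c N J).Adelic → (Fin 2 → ℂ)} (hΦ : Φ ∈ cohForms F E c N J ιinf Kc) (hne : Φ ≠ 0)
    (hP : P.ContainsForm Φ) :
    P.IsHolCotangentAt ιinf Kc ∨ P.IsAntiholCotangentAt ιinf Kc := by
  obtain ⟨Φ₁, h₁, Φ₂, h₂, h12, hP₁, hP₂⟩ := cohFormsContainsFormSplit_holds F E c N J ιinf Kc μ P Φ hΦ hP
  by_cases hz : Φ₁ = 0
  · refine Or.inr ⟨Φ₂, h₂, ?_, hP₂⟩
    rintro rfl
    exact hne (by rw [h12, hz, add_zero])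
  · exact Or.inl ⟨Φ₁, h₁, hz, hP₁⟩

end Summit.HodgeConjecture.HodgeConjecture.Cruxes.H413.CotangentHodgeSplit

end
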